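import Summits.Parity.GeneralizedHardyLittlewood.Theorems.PolymathEpsThreeCeilingGridBoundHighRankActivityFiveBudget

/-!
# Route `PolymathEpsThreeCeiling`, crux `GridBoundHigh` (stmt-Parity-19069): the five-constant certificates reduced
# to REAL INEQUALITIES

Completes the structural half of the last obligation of `stub_cwCertsHigh` along the rank/activity line: the degenerate
fibres (`s₁ = 0`: `RankActivity.lintegral_fibreWeight_five_zero_le`, `RankActivity.lintegral_fibreWeight_five_origin`), the
symmetry reduction, and the assembly `RankActivity.cwCert_of_fiveBudget`:  for `1/5 ≤ ε < 1` and five constants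
`(Λ, β, d₁₀, d₀, c)` satisfying nine `norm_num`-checkable side conditions, the body of `stub_cwCertsHigh` at `(ε, Λ)`
follows from three REAL inequalities —
`fiveBudget ε Λ β d₁₀ d₀ c s₀ s₁ ≤ 1` for `0 < s₁ ≤ s₀`, `s₀ + s₁ ≤ 1 - ε` (three logarithms + three linear terms),
`fiveBudget₀ ε Λ c s₀ ≤ 1` for `0 < s₀ ≤ 1 - ε` (piecewise linear), and `1 + ε ≤ Λ`.
The tabulated constants (item evidence `PARAMS-19069-rankactivity-5const.md`) satisfy them numerically with
`max fiveBudget = 0.975 (j = 17) … 0.990 (j = 40)`; proving these 24 (or one ε-uniform) real inequalities is what remains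
(`CENSUS-19069-orderone.md` §F7: log-free via 4-panel chord bounds if preferred).
Support lemmas for stmt-Parity-19069 only; no summit claim.  Standard axioms.
-/

noncomputable section

open Finset MeasureTheory Set Filter

namespace Summit.Parity.GeneralizedHardyLittlewood.Theses.PolymathEpsThreeCeiling

namespace RankActivity

/-- The fibre budget over a degenerate outer pair `(s₀, 0)`, `s₀ > 0` (piecewise linear in `s₀`). -/
def fiveBudget₀ (ε Λ c s₀ : ℝ) : ℝ :=
  let L := 1 + ε - s₀
  let e := min (1 - ε) L
  let m := min s₀ e
  m / (Λ - c) + (e - m) / c + (L - e) / Λ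

/-- **Degenerate fibres `s₁ = 0 < s₀`**: two atoms at most, the profile is `Λ - c`, then `c`, then `Λ`. -/
theorem lintegral_fibreWeight_five_zero_le {ε Λ β d₁₀ d₀ c : ℝ} (hε : 0 ≤ ε) (hΛ : 0 < Λ) (hc1 : Λ / 2 ≤ c)
    (hc2 : c < Λ) {s₀ : ℝ} (hs0 : 0 < s₀) (hs0η : s₀ ≤ 1 - ε) :
    ∫⁻ u in Ioc (0:ℝ) (1 + ε - (s₀ + 0)),
        ENNReal.ofReal (fibreWeight ε Λ (fiveC c) (fiveAS ε Λ β d₁₀ d₀) (fiveD1 ε d₁₀) (fiveD0 ε d₀)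
          (fiveB ε Λ β) s₀ 0 u)⁻¹
      ≤ ENNReal.ofReal (fiveBudget₀ ε Λ c s₀) := by
  set L := 1 + ε - s₀ with hLdef
  set e := min (1 - ε) L with hedef
  set m := min s₀ e with hmdef
  set W : ℝ → ℝ := fun u => fibreWeight ε Λ (fiveC c) (fiveAS ε Λ β d₁₀ d₀) (fiveD1 ε d₁₀) (fiveD0 ε d₀)
    (fiveB ε Λ β) s₀ 0 u with hWdef
  have hL' : 1 + ε - (s₀ + 0) = L := by rw [hLdef]; ring
  rw [hL']
  show ∫⁻ u in Ioc (0:ℝ) L, ENNReal.ofReal (W u)⁻¹ ≤ _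
  have heL : e ≤ L := min_le_right _ _
  have heη : e ≤ 1 - ε := min_le_left _ _
  have h0m : 0 ≤ m := le_min hs0.le (le_min (by linarith) (by rw [hLdef]; linarith))
  have hme : m ≤ e := min_le_right _ _
  -- the profile
  have hA2 : ∀ u, 0 < u → u ≤ e → W u = if s₀ < u then c else Λ - c := by
    intro u hu0 hue
    have ha0 : 0 < s₀ ∧ u + 0 ≤ 1 - ε := ⟨hs0, by linarith⟩
    have hna1 : ¬ (0 < (0:ℝ) ∧ u + s₀ ≤ 1 - ε) := fun h => lt_irrefl _ h.1
    have hn3 : ¬ ((0 < s₀ ∧ u + 0 ≤ 1 - ε) ∧ (0 < (0:ℝ) ∧ u + s₀ ≤ 1 - ε)) := fun h => hna1 h.2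
    simp only [hWdef, fibreWeight, if_neg hn3, if_pos ha0, fiveC]
    split_ifs <;> ring
  have hA1 : ∀ u, e < u → u ≤ L → W u = Λ := by
    intro u hue huL
    have hue' : 1 - ε < u := by
      rcases min_lt_iff.1 hue with h | h
      · exact h
      · exact absurd huL (not_le.2 h)
    have hna0 : ¬ (0 < s₀ ∧ u + 0 ≤ 1 - ε) := fun h => by linarith [h.2]
    have hna1 : ¬ (0 < (0:ℝ) ∧ u + s₀ ≤ 1 - ε) := fun h => lt_irrefl _ h.1
    have hn3 : ¬ ((0 < s₀ ∧ u + 0 ≤ 1 - ε) ∧ (0 < (0:ℝ) ∧ u + s₀ ≤ 1 - ε)) := fun h => hna0 h.1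
    simp only [hWdef, fibreWeight, if_neg hn3, if_neg hna0, if_neg hna1]
  have hsplit : Ioc (0:ℝ) L = Ioc 0 m ∪ Ioc m e ∪ Ioc e L := by
    rw [Ioc_union_Ioc_eq_Ioc h0m hme, Ioc_union_Ioc_eq_Ioc (h0m.trans hme) heL]
  have P1 : ∫⁻ u in Ioc (0:ℝ) m, ENNReal.ofReal (W u)⁻¹ = ENNReal.ofReal ((m - 0) / (Λ - c)) := by
    rw [← lintegral_Ioc_inv_const h0m]
    refine setLIntegral_congr_fun measurableSet_Ioc fun u hu => ?_
    have hus0 : u ≤ s₀ := hu.2.trans (min_le_left _ _)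
    rw [hA2 u hu.1 (hu.2.trans hme), if_neg (not_lt.2 hus0)]
  have P2 : ∫⁻ u in Ioc m e, ENNReal.ofReal (W u)⁻¹ = ENNReal.ofReal ((e - m) / c) := by
    rw [← lintegral_Ioc_inv_const hme]
    refine setLIntegral_congr_fun measurableSet_Ioc fun u hu => ?_
    have hus0 : s₀ < u := by
      rcases min_lt_iff.1 hu.1 with h | h
      · exact h
      · exact absurd hu.2 (not_le.2 h)
    rw [hA2 u (h0m.trans_lt hu.1) hu.2, if_pos hus0]
  have P3 : ∫⁻ u in Ioc e L, ENNReal.ofReal (W u)⁻¹ = ENNReal.ofReal ((L - e) / Λ) := by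
    rw [← lintegral_Ioc_inv_const heL]
    refine setLIntegral_congr_fun measurableSet_Ioc fun u hu => ?_
    rw [hA1 u hu.1 hu.2]
  have key : ∫⁻ u in Ioc (0:ℝ) L, ENNReal.ofReal (W u)⁻¹ ≤
      ENNReal.ofReal ((m - 0) / (Λ - c)) + ENNReal.ofReal ((e - m) / c) + ENNReal.ofReal ((L - e) / Λ) := by
    rw [hsplit, ← P1, ← P2, ← P3]
    refine (lintegral_union_le _ _ _).trans (add_le_add ?_ le_rfl)
    exact lintegral_union_le _ _ _
  have hl1 : 0 ≤ (m - 0) / (Λ - c) := div_nonneg (by linarith) (by linarith)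
  have hl2 : 0 ≤ (e - m) / c := div_nonneg (sub_nonneg.2 hme) (by linarith)
  have hl3 : 0 ≤ (L - e) / Λ := div_nonneg (sub_nonneg.2 heL) hΛ.le
  have hB : fiveBudget₀ ε Λ c s₀ = (m - 0) / (Λ - c) + (e - m) / c + (L - e) / Λ := by
    show m / (Λ - c) + (e - m) / c + (L - e) / Λ = _; rw [sub_zero]
  rw [hB, ENNReal.ofReal_add (add_nonneg hl1 hl2) hl3, ENNReal.ofReal_add hl1 hl2]
  exact key

/-- **The fibre over the origin `s = 0`**: only one atom, the profile is `Λ`, the budget is `(1+ε)/Λ`. -/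
theorem lintegral_fibreWeight_five_origin {ε Λ β d₁₀ d₀ c : ℝ} (hε : 0 ≤ 1 + ε) :
    ∫⁻ u in Ioc (0:ℝ) (1 + ε - (0 + 0)),
        ENNReal.ofReal (fibreWeight ε Λ (fiveC c) (fiveAS ε Λ β d₁₀ d₀) (fiveD1 ε d₁₀) (fiveD0 ε d₀)
          (fiveB ε Λ β) 0 0 u)⁻¹
      = ENNReal.ofReal ((1 + ε) / Λ) := by
  have hL : (1:ℝ) + ε - (0 + 0) = 1 + ε := by ring
  rw [hL, ← sub_zero (1 + ε), ← lintegral_Ioc_inv_const hε, sub_zero]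
  refine setLIntegral_congr_fun measurableSet_Ioc fun u hu => ?_
  have hna : ¬ (0 < (0:ℝ) ∧ u + 0 ≤ 1 - ε) := fun h => lt_irrefl _ h.1
  have hn3 : ¬ ((0 < (0:ℝ) ∧ u + 0 ≤ 1 - ε) ∧ (0 < (0:ℝ) ∧ u + 0 ≤ 1 - ε)) := fun h => hna h.1
  simp only [fibreWeight, if_neg hn3, if_neg hna]

/-- **Assembly: the five-constant certificate at `(ε, Λ)` from three real inequalities.** -/
theorem cwCert_of_fiveBudget {ε Λ β d₁₀ d₀ c : ℝ} (hε : 1 / 5 ≤ ε) (hε1 : ε < 1) (hΛ : 0 < Λ)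
    (hc1 : Λ / 2 ≤ c) (hc2 : c < Λ) (hd1 : 0 ≤ d₁₀) (hd0 : 0 ≤ d₀) (hβ : 0 < β)
    (hBM : 0 < 2 * β - d₁₀ / fiveS ε) (h1 : 2 * d₁₀ + d₀ < Λ)
    (h2 : β * (3 * (1 - ε) / 2) + 2 * (d₁₀ * (1 - (3 * (1 - ε) / 2) / fiveS ε)) + d₀ < Λ)
    (hT : 1 + ε ≤ Λ)
    (hB : ∀ s₀ s₁ : ℝ, 0 < s₁ → s₁ ≤ s₀ → s₀ + s₁ ≤ 1 - ε → fiveBudget ε Λ β d₁₀ d₀ c s₀ s₁ ≤ 1)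
    (hB0 : ∀ s₀ : ℝ, 0 < s₀ → s₀ ≤ 1 - ε → fiveBudget₀ ε Λ c s₀ ≤ 1) :
    ∃ w : Fin 3 → (Fin 3 → ℝ) → ℝ, (∀ m, Measurable (w m)) ∧
      (∀ m (t : Fin 3 → ℝ), 0 < t m → ∑ i ∈ univ.erase m, t i ≤ 1 - ε → 0 < w m t) ∧
      (∀ m (s : Fin 2 → ℝ), (∀ i, 0 ≤ s i) → ∑ i, s i ≤ 1 - ε →
        ∫⁻ u in Ioc (0:ℝ) (1 + ε - ∑ i, s i), ENNReal.ofReal (w m (Fin.insertNth m u s))⁻¹ ≤ 1) ∧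
      (∀ t : Fin 3 → ℝ, (∀ i, 0 ≤ t i) → ∑ i, t i ≤ 1 + ε →
        ∑ m, (if 0 < t m ∧ ∑ i ∈ univ.erase m, t i ≤ 1 - ε then w m t else 0) ≤ Λ) := by
  refine cwCert_of_fiveConst hε hε1 hΛ hc1 hc2 hd1 hd0 hβ h1.le h2.le ?_
  -- the fibre budgets, first for `s₁ ≤ s₀`
  have main : ∀ s₀ s₁ : ℝ, 0 ≤ s₁ → s₁ ≤ s₀ → s₀ + s₁ ≤ 1 - ε →
      ∫⁻ u in Ioc (0:ℝ) (1 + ε - (s₀ + s₁)),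
        ENNReal.ofReal (fibreWeight ε Λ (fiveC c) (fiveAS ε Λ β d₁₀ d₀) (fiveD1 ε d₁₀) (fiveD0 ε d₀)
          (fiveB ε Λ β) s₀ s₁ u)⁻¹ ≤ 1 := by
    intro s₀ s₁ hs1 hs01 hρ
    rcases hs1.eq_or_lt with hs1z | hs1p
    · -- `s₁ = 0`
      rw [← hs1z]
      rcases (hs1.trans hs01).eq_or_lt with hs0z | hs0p
      · rw [← hs0z, lintegral_fibreWeight_five_origin (by linarith)]
        exact ENNReal.ofReal_le_one.2 ((div_le_one hΛ).2 hT)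
      · refine (lintegral_fibreWeight_five_zero_le (by linarith) hΛ hc1 hc2 hs0p (by linarith)).trans ?_
        exact ENNReal.ofReal_le_one.2 (hB0 s₀ hs0p (by linarith))
    · refine (lintegral_fibreWeight_five_le hε hΛ hc1 hc2 hd1 hd0 hβ hBM h1 h2 hs1p hs01 hρ).trans ?_
      exact ENNReal.ofReal_le_one.2 (hB s₀ s₁ hs1p hs01 hρ)
  intro s₀ s₁ hs0 hs1 hρ
  rcases le_total s₁ s₀ with h | h
  · exact main s₀ s₁ hs1 h hρ
  · have e : (fun u => ENNReal.ofReal (fibreWeight ε Λ (fiveC c) (fiveAS ε Λ β d₁₀ d₀) (fiveD1 ε d₁₀)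
        (fiveD0 ε d₀) (fiveB ε Λ β) s₀ s₁ u)⁻¹) = fun u => ENNReal.ofReal (fibreWeight ε Λ (fiveC c)
        (fiveAS ε Λ β d₁₀ d₀) (fiveD1 ε d₁₀) (fiveD0 ε d₀) (fiveB ε Λ β) s₁ s₀ u)⁻¹ := by
      funext u; rw [fibreWeight_comm]
    rw [e, add_comm s₀ s₁]
    exact main s₁ s₀ hs0 h (by linarith)

end RankActivity

end Summit.Parity.GeneralizedHardyLittlewood.Theses.PolymathEpsThreeCeiling

end
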